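import Literature.MathematicalPhysics.QuantumLattice.HubbardTTPrimeMultilinearBoxWordAdapters
import Literature.MathematicalPhysics.QuantumLattice.HubbardTTPrimeBoxWordExtension
import Literature.MathematicalPhysics.QuantumLattice.HubbardNNNHoppingEnergyDensityRegionBounds
import Literature.MathematicalPhysics.QuantumLattice.HubbardFillingBoxEnergyBounds
import Literature.MathematicalPhysics.QuantumLattice.HubbardNNNHoppingEnergyDensityParticleHole
import HarnessLib

/-!
# Ventures/CertifiedManyBodySolver — Certificates/HubbardSquare_transportClosure_Kit.lean
# (hubbard-fast-reuse-1 g0, cell hubbard-fast, D-0154 (A) CERTIFICATE REUSE: the TRANSPORT-CLOSURE kit, part 1 = SLICES and embeddings; part 2 = `…_KitLaws.lean` = the laws)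

Generic one-step TRANSPORT adapters for the cell's kernel `e₀` words (surrogate-1 `_mlword_Icc` contract: coordinates
`θ = ![U/t, t'/t, n]`, floor/cap = 8 literal coefficients on `[1, θ0, θ1, θ2, θ0θ1, θ0θ2, θ1θ2, θ0θ1θ2]`).
Every adapter takes one or two EXISTING words (cited by name by the consumer files, hypotheses passed through verbatim),
reads them on a coordinate SLICE (a `U`-slice is bilinear in `(t', n)`, an `n`-slice bilinear in `(U, t')`; particle–hole
images `e(t,s,U,n) = e(t,-s,U,2-n) + U(n-1)` folded exactly), applies ONE kernel law of the tree, and returns a literal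
8-coefficient floor/cap on the target cell whose validity against the raw (rational-function) transported bound is checked at
the eight vertices (vertex rule for trilinear forms, `trilinear_nonneg_on_Icc₃`). Laws:
* `tc_mlFloor_Uchord`  — joint concavity in `(t',U)` read along `U` (`energyDensityTT'_ge_convexComb`): floors at `U₀ < U₁` ⇒ floor between;
* `tc_mlCap_Usecx`     — concavity + monotonicity in `U`: cap at `U₁`, floor at `U₀ < U₁` ⇒ cap ABOVE `U₁` with slope `S ≥ (C(U₁)-F(U₀))/(U₁-U₀)`;
* `tc_mlFloor_Umono_above` / `tc_mlCap_Umono_below` — `energyDensityTT'_mono_U` (floors carry up, caps carry down in `U`);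
* `tc_mlCap_nchord`    — convexity in `n` (`energyDensityTT'_le_density_chord_of_mem_Icc`): caps at `n_A < n_B` ⇒ cap between.
Slices: `tc_sliceU_floor/cap`, `tc_sliceN_floor/cap` (direct) and `…_phImage` (through the exact particle–hole map).
HONEST FRAMING: bookkeeping adapters; they certify nothing by themselves; every consumer word inherits exactly the hypotheses of
the words it cites; no number of record; not a phase word; no summit statement is proved here; not a superconductivity verdict.
-/

namespace Summit.Ventures.CertifiedManyBodySolver.Certificates

open Literature.MathematicalPhysics.QuantumLattice
open Literature.MathematicalPhysics.QuantumLattice.ThermodynamicLimit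
open Set

/-! ### §0 Sub-box restriction -/

/-- **Restriction of a box statement to a sub-box** (six scalar comparisons). [cite: Neumaier2004CompleteSearch, §11] -/
theorem tc_forall_Icc₃_restrict {P : (Fin 3 → ℝ) → Prop}
    {a₀ a₁ a₂ b₀ b₁ b₂ a₀' a₁' a₂' b₀' b₁' b₂' : ℝ}
    (h : ∀ θ ∈ Set.Icc (![a₀, a₁, a₂] : Fin 3 → ℝ) ![b₀, b₁, b₂], P θ)
    (h₀ : a₀ ≤ a₀') (h₀' : b₀' ≤ b₀) (h₁ : a₁ ≤ a₁') (h₁' : b₁' ≤ b₁) (h₂ : a₂ ≤ a₂') (h₂' : b₂' ≤ b₂) :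
    ∀ θ ∈ Set.Icc (![a₀', a₁', a₂'] : Fin 3 → ℝ) ![b₀', b₁', b₂'], P θ := by
  intro θ hθ
  obtain ⟨⟨k1, k2⟩, ⟨k3, k4⟩, ⟨k5, k6⟩⟩ := mem_Icc_vec3_iff.1 hθ
  exact h θ (mem_Icc_vec3_iff.2
    ⟨⟨h₀.trans k1, k2.trans h₀'⟩, ⟨h₁.trans k3, k4.trans h₁'⟩, ⟨h₂.trans k5, k6.trans h₂'⟩⟩)

/-! ### §1 Slices of a multilinear word -/

/-- **`U`-slice of a multilinear word, floor side**: at `U = U₀` inside the word's box the floor is the bilinear form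
`(c₀ + c₁U₀) + (c₂ + c₄U₀) s + (c₃ + c₅U₀) n + (c₆ + c₇U₀) s n` on any sub-rectangle of the word's `(t', n)`-range.
[cite: Rikun1997MultilinearEnvelope, Thm 1.1] -/
theorem tc_sliceU_floor (t : ℝ) {a₀ a₁ a₂ b₀ b₁ b₂ U₀ s₁ s₂ n₁ n₂ : ℝ}
    {c₀ c₁ c₂ c₃ c₄ c₅ c₆ c₇ d₀ d₁ d₂ d₃ d₄ d₅ d₆ d₇ : ℝ}
    (h : ∀ θ ∈ Set.Icc (![a₀, a₁, a₂] : Fin 3 → ℝ) ![b₀, b₁, b₂],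
      c₀ + c₁ * θ 0 + c₂ * θ 1 + c₃ * θ 2 + c₄ * θ 0 * θ 1 + c₅ * θ 0 * θ 2 + c₆ * θ 1 * θ 2 +
          c₇ * θ 0 * θ 1 * θ 2 ≤ energyDensityTT' t (θ 1) (θ 0) (θ 2) ∧
        energyDensityTT' t (θ 1) (θ 0) (θ 2) ≤ d₀ + d₁ * θ 0 + d₂ * θ 1 + d₃ * θ 2 + d₄ * θ 0 * θ 1 +
          d₅ * θ 0 * θ 2 + d₆ * θ 1 * θ 2 + d₇ * θ 0 * θ 1 * θ 2)
    (hU₁ : a₀ ≤ U₀) (hU₂ : U₀ ≤ b₀) (hs₁ : a₁ ≤ s₁) (hs₂ : s₂ ≤ b₁) (hn₁ : a₂ ≤ n₁) (hn₂ : n₂ ≤ b₂) :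
    ∀ s n : ℝ, s₁ ≤ s → s ≤ s₂ → n₁ ≤ n → n ≤ n₂ →
      (c₀ + c₁ * U₀) + (c₂ + c₄ * U₀) * s + (c₃ + c₅ * U₀) * n + (c₆ + c₇ * U₀) * s * n ≤
        energyDensityTT' t s U₀ n := by
  intro s n k3 k4 k5 k6
  have h₁ := (h ![U₀, s, n] (mem_Icc_vec3_iff.2
    ⟨⟨hU₁, hU₂⟩, ⟨hs₁.trans k3, k4.trans hs₂⟩, ⟨hn₁.trans k5, k6.trans hn₂⟩⟩)).1
  simp only [Matrix.cons_val_zero, Matrix.cons_val_one, Matrix.cons_val] at h₁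
  linear_combination h₁

/-- **`U`-slice of a multilinear word, cap side.** [cite: Rikun1997MultilinearEnvelope, Thm 1.1] -/
theorem tc_sliceU_cap (t : ℝ) {a₀ a₁ a₂ b₀ b₁ b₂ U₀ s₁ s₂ n₁ n₂ : ℝ}
    {c₀ c₁ c₂ c₃ c₄ c₅ c₆ c₇ d₀ d₁ d₂ d₃ d₄ d₅ d₆ d₇ : ℝ}
    (h : ∀ θ ∈ Set.Icc (![a₀, a₁, a₂] : Fin 3 → ℝ) ![b₀, b₁, b₂],
      c₀ + c₁ * θ 0 + c₂ * θ 1 + c₃ * θ 2 + c₄ * θ 0 * θ 1 + c₅ * θ 0 * θ 2 + c₆ * θ 1 * θ 2 +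
          c₇ * θ 0 * θ 1 * θ 2 ≤ energyDensityTT' t (θ 1) (θ 0) (θ 2) ∧
        energyDensityTT' t (θ 1) (θ 0) (θ 2) ≤ d₀ + d₁ * θ 0 + d₂ * θ 1 + d₃ * θ 2 + d₄ * θ 0 * θ 1 +
          d₅ * θ 0 * θ 2 + d₆ * θ 1 * θ 2 + d₇ * θ 0 * θ 1 * θ 2)
    (hU₁ : a₀ ≤ U₀) (hU₂ : U₀ ≤ b₀) (hs₁ : a₁ ≤ s₁) (hs₂ : s₂ ≤ b₁) (hn₁ : a₂ ≤ n₁) (hn₂ : n₂ ≤ b₂) :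
    ∀ s n : ℝ, s₁ ≤ s → s ≤ s₂ → n₁ ≤ n → n ≤ n₂ →
      energyDensityTT' t s U₀ n ≤
        (d₀ + d₁ * U₀) + (d₂ + d₄ * U₀) * s + (d₃ + d₅ * U₀) * n + (d₆ + d₇ * U₀) * s * n := by
  intro s n k3 k4 k5 k6
  have h₁ := (h ![U₀, s, n] (mem_Icc_vec3_iff.2
    ⟨⟨hU₁, hU₂⟩, ⟨hs₁.trans k3, k4.trans hs₂⟩, ⟨hn₁.trans k5, k6.trans hn₂⟩⟩)).2
  simp only [Matrix.cons_val_zero, Matrix.cons_val_one, Matrix.cons_val] at h₁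
  linear_combination h₁

/-- **`n`-slice of a multilinear word, floor side**: at density `n₀` inside the word's box the floor is bilinear in `(U, t')`.
[cite: Rikun1997MultilinearEnvelope, Thm 1.1] -/
theorem tc_sliceN_floor (t : ℝ) {a₀ a₁ a₂ b₀ b₁ b₂ n₀ U₁ U₂ s₁ s₂ : ℝ}
    {c₀ c₁ c₂ c₃ c₄ c₅ c₆ c₇ d₀ d₁ d₂ d₃ d₄ d₅ d₆ d₇ : ℝ}
    (h : ∀ θ ∈ Set.Icc (![a₀, a₁, a₂] : Fin 3 → ℝ) ![b₀, b₁, b₂],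
      c₀ + c₁ * θ 0 + c₂ * θ 1 + c₃ * θ 2 + c₄ * θ 0 * θ 1 + c₅ * θ 0 * θ 2 + c₆ * θ 1 * θ 2 +
          c₇ * θ 0 * θ 1 * θ 2 ≤ energyDensityTT' t (θ 1) (θ 0) (θ 2) ∧
        energyDensityTT' t (θ 1) (θ 0) (θ 2) ≤ d₀ + d₁ * θ 0 + d₂ * θ 1 + d₃ * θ 2 + d₄ * θ 0 * θ 1 +
          d₅ * θ 0 * θ 2 + d₆ * θ 1 * θ 2 + d₇ * θ 0 * θ 1 * θ 2)
    (hn₁ : a₂ ≤ n₀) (hn₂ : n₀ ≤ b₂) (hU₁ : a₀ ≤ U₁) (hU₂ : U₂ ≤ b₀) (hs₁ : a₁ ≤ s₁) (hs₂ : s₂ ≤ b₁) :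
    ∀ U s : ℝ, U₁ ≤ U → U ≤ U₂ → s₁ ≤ s → s ≤ s₂ →
      (c₀ + c₃ * n₀) + (c₁ + c₅ * n₀) * U + (c₂ + c₆ * n₀) * s + (c₄ + c₇ * n₀) * U * s ≤
        energyDensityTT' t s U n₀ := by
  intro U s k1 k2 k3 k4
  have h₁ := (h ![U, s, n₀] (mem_Icc_vec3_iff.2
    ⟨⟨hU₁.trans k1, k2.trans hU₂⟩, ⟨hs₁.trans k3, k4.trans hs₂⟩, ⟨hn₁, hn₂⟩⟩)).1
  simp only [Matrix.cons_val_zero, Matrix.cons_val_one, Matrix.cons_val] at h₁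
  linear_combination h₁

/-- **`n`-slice of a multilinear word, cap side.** [cite: Rikun1997MultilinearEnvelope, Thm 1.1] -/
theorem tc_sliceN_cap (t : ℝ) {a₀ a₁ a₂ b₀ b₁ b₂ n₀ U₁ U₂ s₁ s₂ : ℝ}
    {c₀ c₁ c₂ c₃ c₄ c₅ c₆ c₇ d₀ d₁ d₂ d₃ d₄ d₅ d₆ d₇ : ℝ}
    (h : ∀ θ ∈ Set.Icc (![a₀, a₁, a₂] : Fin 3 → ℝ) ![b₀, b₁, b₂],
      c₀ + c₁ * θ 0 + c₂ * θ 1 + c₃ * θ 2 + c₄ * θ 0 * θ 1 + c₅ * θ 0 * θ 2 + c₆ * θ 1 * θ 2 +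
          c₇ * θ 0 * θ 1 * θ 2 ≤ energyDensityTT' t (θ 1) (θ 0) (θ 2) ∧
        energyDensityTT' t (θ 1) (θ 0) (θ 2) ≤ d₀ + d₁ * θ 0 + d₂ * θ 1 + d₃ * θ 2 + d₄ * θ 0 * θ 1 +
          d₅ * θ 0 * θ 2 + d₆ * θ 1 * θ 2 + d₇ * θ 0 * θ 1 * θ 2)
    (hn₁ : a₂ ≤ n₀) (hn₂ : n₀ ≤ b₂) (hU₁ : a₀ ≤ U₁) (hU₂ : U₂ ≤ b₀) (hs₁ : a₁ ≤ s₁) (hs₂ : s₂ ≤ b₁) :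
    ∀ U s : ℝ, U₁ ≤ U → U ≤ U₂ → s₁ ≤ s → s ≤ s₂ →
      energyDensityTT' t s U n₀ ≤
        (d₀ + d₃ * n₀) + (d₁ + d₅ * n₀) * U + (d₂ + d₆ * n₀) * s + (d₄ + d₇ * n₀) * U * s := by
  intro U s k1 k2 k3 k4
  have h₁ := (h ![U, s, n₀] (mem_Icc_vec3_iff.2
    ⟨⟨hU₁.trans k1, k2.trans hU₂⟩, ⟨hs₁.trans k3, k4.trans hs₂⟩, ⟨hn₁, hn₂⟩⟩)).2
  simp only [Matrix.cons_val_zero, Matrix.cons_val_one, Matrix.cons_val] at h₁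
  linear_combination h₁

/-! ### §1b Slices through the exact particle–hole map `e(t,s,U,n) = e(t,-s,U,2-n) + U(n-1)` -/

/-- **`U`-slice through the particle–hole image, floor side**: a word on the HOLE-side box `[a₀,b₀]×[a₁,b₁]×[a₂,b₂]`
(`0 < a₂`, `b₂ < 2`) read at `U₀` gives, on the image rectangle `s ∈ [-b₁,-a₁]`, `n ∈ [2-b₂, 2-a₂]`, the bilinear floor
`P(U₀,-s,2-n) + U₀(n-1)`. [cite: LiebWuPhysicaA2003, §1 eq. (3)] -/
theorem tc_sliceU_floor_phImage (t : ℝ) {a₀ a₁ a₂ b₀ b₁ b₂ U₀ s₁ s₂ n₁ n₂ : ℝ}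
    {c₀ c₁ c₂ c₃ c₄ c₅ c₆ c₇ d₀ d₁ d₂ d₃ d₄ d₅ d₆ d₇ : ℝ}
    (h : ∀ θ ∈ Set.Icc (![a₀, a₁, a₂] : Fin 3 → ℝ) ![b₀, b₁, b₂],
      c₀ + c₁ * θ 0 + c₂ * θ 1 + c₃ * θ 2 + c₄ * θ 0 * θ 1 + c₅ * θ 0 * θ 2 + c₆ * θ 1 * θ 2 +
          c₇ * θ 0 * θ 1 * θ 2 ≤ energyDensityTT' t (θ 1) (θ 0) (θ 2) ∧
        energyDensityTT' t (θ 1) (θ 0) (θ 2) ≤ d₀ + d₁ * θ 0 + d₂ * θ 1 + d₃ * θ 2 + d₄ * θ 0 * θ 1 +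
          d₅ * θ 0 * θ 2 + d₆ * θ 1 * θ 2 + d₇ * θ 0 * θ 1 * θ 2)
    (hU : 0 ≤ U₀) (ha₂ : 0 < a₂) (hb₂ : b₂ < 2)
    (hU₁ : a₀ ≤ U₀) (hU₂ : U₀ ≤ b₀) (hs₁ : -b₁ ≤ s₁) (hs₂ : s₂ ≤ -a₁) (hn₁ : 2 - b₂ ≤ n₁) (hn₂ : n₂ ≤ 2 - a₂) :
    ∀ s n : ℝ, s₁ ≤ s → s ≤ s₂ → n₁ ≤ n → n ≤ n₂ →
      ((c₀ + c₁ * U₀) + 2 * (c₃ + c₅ * U₀) - U₀) + (-(c₂ + c₄ * U₀) - 2 * (c₆ + c₇ * U₀)) * s +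
          (U₀ - (c₃ + c₅ * U₀)) * n + (c₆ + c₇ * U₀) * s * n ≤ energyDensityTT' t s U₀ n := by
  intro s n k3 k4 k5 k6
  have h₁ := (h ![U₀, -s, 2 - n] (mem_Icc_vec3_iff.2
    ⟨⟨hU₁, hU₂⟩, ⟨show a₁ ≤ -s by linarith, show -s ≤ b₁ by linarith⟩,
      ⟨show a₂ ≤ 2 - n by linarith, show 2 - n ≤ b₂ by linarith⟩⟩)).1
  simp only [Matrix.cons_val_zero, Matrix.cons_val_one, Matrix.cons_val] at h₁
  have hph := energyDensityTT'_particleHole t s hU (n := n) (by linarith) (by linarith)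
  rw [hph]
  linear_combination h₁

/-- **`U`-slice through the particle–hole image, cap side.** [cite: LiebWuPhysicaA2003, §1 eq. (3)] -/
theorem tc_sliceU_cap_phImage (t : ℝ) {a₀ a₁ a₂ b₀ b₁ b₂ U₀ s₁ s₂ n₁ n₂ : ℝ}
    {c₀ c₁ c₂ c₃ c₄ c₅ c₆ c₇ d₀ d₁ d₂ d₃ d₄ d₅ d₆ d₇ : ℝ}
    (h : ∀ θ ∈ Set.Icc (![a₀, a₁, a₂] : Fin 3 → ℝ) ![b₀, b₁, b₂],
      c₀ + c₁ * θ 0 + c₂ * θ 1 + c₃ * θ 2 + c₄ * θ 0 * θ 1 + c₅ * θ 0 * θ 2 + c₆ * θ 1 * θ 2 +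
          c₇ * θ 0 * θ 1 * θ 2 ≤ energyDensityTT' t (θ 1) (θ 0) (θ 2) ∧
        energyDensityTT' t (θ 1) (θ 0) (θ 2) ≤ d₀ + d₁ * θ 0 + d₂ * θ 1 + d₃ * θ 2 + d₄ * θ 0 * θ 1 +
          d₅ * θ 0 * θ 2 + d₆ * θ 1 * θ 2 + d₇ * θ 0 * θ 1 * θ 2)
    (hU : 0 ≤ U₀) (ha₂ : 0 < a₂) (hb₂ : b₂ < 2)
    (hU₁ : a₀ ≤ U₀) (hU₂ : U₀ ≤ b₀) (hs₁ : -b₁ ≤ s₁) (hs₂ : s₂ ≤ -a₁) (hn₁ : 2 - b₂ ≤ n₁) (hn₂ : n₂ ≤ 2 - a₂) :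
    ∀ s n : ℝ, s₁ ≤ s → s ≤ s₂ → n₁ ≤ n → n ≤ n₂ →
      energyDensityTT' t s U₀ n ≤
        ((d₀ + d₁ * U₀) + 2 * (d₃ + d₅ * U₀) - U₀) + (-(d₂ + d₄ * U₀) - 2 * (d₆ + d₇ * U₀)) * s +
          (U₀ - (d₃ + d₅ * U₀)) * n + (d₆ + d₇ * U₀) * s * n := by
  intro s n k3 k4 k5 k6
  have h₁ := (h ![U₀, -s, 2 - n] (mem_Icc_vec3_iff.2
    ⟨⟨hU₁, hU₂⟩, ⟨show a₁ ≤ -s by linarith, show -s ≤ b₁ by linarith⟩,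
      ⟨show a₂ ≤ 2 - n by linarith, show 2 - n ≤ b₂ by linarith⟩⟩)).2
  simp only [Matrix.cons_val_zero, Matrix.cons_val_one, Matrix.cons_val] at h₁
  have hph := energyDensityTT'_particleHole t s hU (n := n) (by linarith) (by linarith)
  rw [hph]
  linear_combination h₁

/-- **`n`-slice through the particle–hole image, floor side**: a word on the HOLE-side box read at the image density `n₀`
(`0 < n₀ < 2`, `2 - n₀ ∈ [a₂, b₂]`) gives on `U ∈ [U₁,U₂] ⊆ [a₀,b₀]` (`U₁ ≥ 0`), `s ∈ [s₁,s₂] ⊆ [-b₁,-a₁]` the bilinear floor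
`P(U,-s,2-n₀) + U(n₀-1)`. [cite: LiebWuPhysicaA2003, §1 eq. (3)] -/
theorem tc_sliceN_floor_phImage (t : ℝ) {a₀ a₁ a₂ b₀ b₁ b₂ n₀ U₁ U₂ s₁ s₂ : ℝ}
    {c₀ c₁ c₂ c₃ c₄ c₅ c₆ c₇ d₀ d₁ d₂ d₃ d₄ d₅ d₆ d₇ : ℝ}
    (h : ∀ θ ∈ Set.Icc (![a₀, a₁, a₂] : Fin 3 → ℝ) ![b₀, b₁, b₂],
      c₀ + c₁ * θ 0 + c₂ * θ 1 + c₃ * θ 2 + c₄ * θ 0 * θ 1 + c₅ * θ 0 * θ 2 + c₆ * θ 1 * θ 2 +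
          c₇ * θ 0 * θ 1 * θ 2 ≤ energyDensityTT' t (θ 1) (θ 0) (θ 2) ∧
        energyDensityTT' t (θ 1) (θ 0) (θ 2) ≤ d₀ + d₁ * θ 0 + d₂ * θ 1 + d₃ * θ 2 + d₄ * θ 0 * θ 1 +
          d₅ * θ 0 * θ 2 + d₆ * θ 1 * θ 2 + d₇ * θ 0 * θ 1 * θ 2)
    (hn0 : 0 < n₀) (hn2 : n₀ < 2) (hU0 : 0 ≤ U₁)
    (hn₁ : a₂ ≤ 2 - n₀) (hn₂ : 2 - n₀ ≤ b₂) (hU₁ : a₀ ≤ U₁) (hU₂ : U₂ ≤ b₀) (hs₁ : -b₁ ≤ s₁) (hs₂ : s₂ ≤ -a₁) :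
    ∀ U s : ℝ, U₁ ≤ U → U ≤ U₂ → s₁ ≤ s → s ≤ s₂ →
      (c₀ + c₃ * (2 - n₀)) + (c₁ + c₅ * (2 - n₀) + (n₀ - 1)) * U + (-(c₂ + c₆ * (2 - n₀))) * s +
          (-(c₄ + c₇ * (2 - n₀))) * U * s ≤ energyDensityTT' t s U n₀ := by
  intro U s k1 k2 k3 k4
  have h₁ := (h ![U, -s, 2 - n₀] (mem_Icc_vec3_iff.2
    ⟨⟨hU₁.trans k1, k2.trans hU₂⟩, ⟨show a₁ ≤ -s by linarith, show -s ≤ b₁ by linarith⟩, ⟨hn₁, hn₂⟩⟩)).1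
  simp only [Matrix.cons_val_zero, Matrix.cons_val_one, Matrix.cons_val] at h₁
  have hph := energyDensityTT'_particleHole t s (hU0.trans k1) hn0 hn2
  rw [hph]
  linear_combination h₁

/-- **`n`-slice through the particle–hole image, cap side.** [cite: LiebWuPhysicaA2003, §1 eq. (3)] -/
theorem tc_sliceN_cap_phImage (t : ℝ) {a₀ a₁ a₂ b₀ b₁ b₂ n₀ U₁ U₂ s₁ s₂ : ℝ}
    {c₀ c₁ c₂ c₃ c₄ c₅ c₆ c₇ d₀ d₁ d₂ d₃ d₄ d₅ d₆ d₇ : ℝ}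
    (h : ∀ θ ∈ Set.Icc (![a₀, a₁, a₂] : Fin 3 → ℝ) ![b₀, b₁, b₂],
      c₀ + c₁ * θ 0 + c₂ * θ 1 + c₃ * θ 2 + c₄ * θ 0 * θ 1 + c₅ * θ 0 * θ 2 + c₆ * θ 1 * θ 2 +
          c₇ * θ 0 * θ 1 * θ 2 ≤ energyDensityTT' t (θ 1) (θ 0) (θ 2) ∧
        energyDensityTT' t (θ 1) (θ 0) (θ 2) ≤ d₀ + d₁ * θ 0 + d₂ * θ 1 + d₃ * θ 2 + d₄ * θ 0 * θ 1 +
          d₅ * θ 0 * θ 2 + d₆ * θ 1 * θ 2 + d₇ * θ 0 * θ 1 * θ 2)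
    (hn0 : 0 < n₀) (hn2 : n₀ < 2) (hU0 : 0 ≤ U₁)
    (hn₁ : a₂ ≤ 2 - n₀) (hn₂ : 2 - n₀ ≤ b₂) (hU₁ : a₀ ≤ U₁) (hU₂ : U₂ ≤ b₀) (hs₁ : -b₁ ≤ s₁) (hs₂ : s₂ ≤ -a₁) :
    ∀ U s : ℝ, U₁ ≤ U → U ≤ U₂ → s₁ ≤ s → s ≤ s₂ →
      energyDensityTT' t s U n₀ ≤
        (d₀ + d₃ * (2 - n₀)) + (d₁ + d₅ * (2 - n₀) + (n₀ - 1)) * U + (-(d₂ + d₆ * (2 - n₀))) * s +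
          (-(d₄ + d₇ * (2 - n₀))) * U * s := by
  intro U s k1 k2 k3 k4
  have h₁ := (h ![U, -s, 2 - n₀] (mem_Icc_vec3_iff.2
    ⟨⟨hU₁.trans k1, k2.trans hU₂⟩, ⟨show a₁ ≤ -s by linarith, show -s ≤ b₁ by linarith⟩, ⟨hn₁, hn₂⟩⟩)).2
  simp only [Matrix.cons_val_zero, Matrix.cons_val_one, Matrix.cons_val] at h₁
  have hph := energyDensityTT'_particleHole t s (hU0.trans k1) hn0 hn2
  rw [hph]
  linear_combination h₁

/-! ### §3 Constant words as multilinear words -/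

/-- **Constant word ⇒ multilinear word** (embedding with zero coefficients). [cite: Neumaier2004CompleteSearch, §16] -/
theorem tc_mlword_of_constWord (t : ℝ) {lo hi : Fin 3 → ℝ} {F C : ℝ}
    (h : ∀ θ ∈ Set.Icc lo hi,
      F ≤ energyDensityTT' t (θ 1) (θ 0) (θ 2) ∧ energyDensityTT' t (θ 1) (θ 0) (θ 2) ≤ C) :
    ∀ θ ∈ Set.Icc lo hi,
      F + 0 * θ 0 + 0 * θ 1 + 0 * θ 2 + 0 * θ 0 * θ 1 + 0 * θ 0 * θ 2 + 0 * θ 1 * θ 2 +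
          0 * θ 0 * θ 1 * θ 2 ≤ energyDensityTT' t (θ 1) (θ 0) (θ 2) ∧
        energyDensityTT' t (θ 1) (θ 0) (θ 2) ≤ C + 0 * θ 0 + 0 * θ 1 + 0 * θ 2 + 0 * θ 0 * θ 1 +
          0 * θ 0 * θ 2 + 0 * θ 1 * θ 2 + 0 * θ 0 * θ 1 * θ 2 := by
  intro θ hθ
  have h₁ := h θ hθ
  constructor <;> linarith [h₁.1, h₁.2]

/-- **Affine particle–hole word ⇒ multilinear word**: `lo + θ0(θ2-1) ≤ e ≤ hi + θ0(θ2-1)` in the 8-coefficient shape.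
[cite: LiebWuPhysicaA2003, §1 eq. (3)] -/
theorem tc_mlword_of_phAffineWord (t : ℝ) {lo hi : Fin 3 → ℝ} {F C : ℝ}
    (h : ∀ θ ∈ Set.Icc lo hi,
      F + θ 0 * (θ 2 - 1) ≤ energyDensityTT' t (θ 1) (θ 0) (θ 2) ∧
        energyDensityTT' t (θ 1) (θ 0) (θ 2) ≤ C + θ 0 * (θ 2 - 1)) :
    ∀ θ ∈ Set.Icc lo hi,
      F + (-1) * θ 0 + 0 * θ 1 + 0 * θ 2 + 0 * θ 0 * θ 1 + 1 * θ 0 * θ 2 + 0 * θ 1 * θ 2 +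
          0 * θ 0 * θ 1 * θ 2 ≤ energyDensityTT' t (θ 1) (θ 0) (θ 2) ∧
        energyDensityTT' t (θ 1) (θ 0) (θ 2) ≤ C + (-1) * θ 0 + 0 * θ 1 + 0 * θ 2 + 0 * θ 0 * θ 1 +
          1 * θ 0 * θ 2 + 0 * θ 1 * θ 2 + 0 * θ 0 * θ 1 * θ 2 := by
  intro θ hθ
  have h₁ := h θ hθ
  constructor
  · linear_combination h₁.1
  · linear_combination h₁.2

end Summit.Ventures.CertifiedManyBodySolver.Certificates
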